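import Summits.QuantumFields.YangMills.Theorems.IR.Negative.TypShellCondFalseFixedMesh

/-!
# Crux `IR` (stmt-QuantumFields-19354) · crux-ideate seat 2 (lens: negation), GEN 5 sketch:
# THE FRAME-TWIST ROW — the fixed-mesh row obstruction WITHOUT a centre (every nontrivial compact `G`)

Slot of record: «af-pincer-U» (sha16 fc8c6b10a3fbcbe2), clause (i) of `TypShellCondUKP` = clause (i_T) of
`TypShellCond` VERBATIM, so everything below is stated against the tree's `OnsetFormats.TypShellCond` / `ClauseI`
exactly like the landed central-twist chain `Theorems/IR/Negative/FixedMesh/*` (cruxidea-8), whose conclusion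
`not_typShellCond_fixedMesh` needs a CENTRAL `g₀` with `ρ g₀ = c • 1`, `c ≠ 1`.

NEW LEVER (this file): the RIM-TOP TWIST `topTwist b k` — right-multiply every vertical link from height `b` to
height `b + 1` by `(k (upper endpoint))⁻¹`, `k : Site 4 → G` ARBITRARY (non-central allowed).  On every cell of the
row layer it IS the gauge transformation `layerGauge b k` (`= k` on the site layer `b+1`, `= 1` elsewhere) — so the
typicality of frozen RIM cells transfers by gauge invariance — while on every window cell OFF the row it is the
identity — so the pair `(ζ, topTwist b k ζ)` is ADMISSIBLE for clause (i_T) at `Y = rowCells n` (exact agreement on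
the frozen window plates, no conjugation of the plates: this is NOT a gauge pair globally, the twist is physical).
The film `Y` then sees its whole inner rim rotated by `k` relative to the plates; at fixed mesh and `β → ∞` it follows
the rim (zero-deficit follow state; frame stiffness `β/b` across the window beats the plates' zero-mean residual
anisotropy), and the cell-0 column read against the σ-staple moves from `≈ 1` to `≈ Re χ_ρ(k₀)/N < 1`.

CONTENT.  §1 geometry of `topTwist` (PROVED); §2 clause (i_T) ⇒ two-kernel bound `≤ 2ε` for the admissible pair
(PROVED); §3 the twisted staple `staple (topTwist ζ) = (A k A⁻¹) · staple ζ` (PROVED); §4 the two named inputs as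
`Prop`s — `TopTwistTransfer` (field-dependent gauge invariance of the torus Wilson measure; M) and `FrameValueBound`
(twisted-film freezing read on the σ-staple; M–L, fixed-volume Laplace with boundary) — and the central-constant
sanity anchor `topTwist_const_eq_layerTwist` (PROVED: then the chain IS the tree chain at layer `b`);
§5 the composition `not_typShellCond_frame` (PROVED from §1–§4 + tree `torusLoopFreezing`, `integral_loopObs_torus`):
for EVERY compact `G`, faithful continuous unitary `ρ`, ANY `r < 1 − 2ε` delivered by the stubs, every mesh `b ≥ 1`
and window `n`, `4·#cells·δ < 1`: `∃ β₀ ∀ β ≥ β₀, ¬ TypShellCond ρ β b n ε δ`.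
-/

set_option autoImplicit false

noncomputable section

open MeasureTheory Filter Topology
open Literature.MathematicalPhysics.QuantumLattice
open Literature.MathematicalPhysics.QuantumFieldTheory (wilsonMeasure GaugeConfig isProbabilityMeasure_wilsonMeasure)
open Literature.Probability.LatticeModels
open Summit.QuantumFields.YangMills.Cruxes.IR.Tempered (cellEdges windowCells regionEdges)
open Summit.QuantumFields.YangMills.Cruxes.IR.ShellTempered (windowCellsPlus)
open Summit.QuantumFields.YangMills.Cruxes.IR.OnsetFormats (TypShellCond shellCount)
open Summit.QuantumFields.YangMills.Cruxes.IR.FixedMesh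

namespace Summit.QuantumFields.YangMills.Cruxes.IR.CruxIdea2g5

/-! ## §1 The rim-top twist and its geometry (PROVED) -/

section Geometry

variable {G : Type} [Group G]

/-- The RIM-TOP TWIST: right-multiply every vertical link based at height `b` (from `b` to `b+1`) by
`(k (upper endpoint))⁻¹`; `k : Site 4 → G` is an arbitrary site function (read only on the site layer `b + 1`). -/
def topTwist (b : ℕ) (k : Site 4 → G) (U : LGConfig 4 G) : LGConfig 4 G :=
  fun e => if e.2 = 0 ∧ e.1 0 = (b : ℤ) then U e * (k (e.1 + Pi.single (0 : Fin 4) 1))⁻¹ else U e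

/-- The layer gauge function: `k` on the site layer `x 0 = b + 1`, `1` elsewhere. -/
def layerGauge (b : ℕ) (k : Site 4 → G) : Site 4 → G :=
  fun x => if x 0 = (b : ℤ) + 1 then k x else 1

theorem add_single_apply_zero (x : Site 4) (i : Fin 4) :
    ((x + Pi.single i (1 : ℤ) : Site 4)) 0 = x 0 + if i = 0 then 1 else 0 := by
  simp only [Pi.add_apply, Pi.single_apply]
  by_cases h : i = 0
  · subst h; simp
  · have h' : (0 : Fin 4) ≠ i := fun h0 => h h0.symm
    simp [h, h']

/-- **PROVED.** On every edge based at height `≤ b` the rim-top twist IS the gauge transformation by `layerGauge b k`. -/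
theorem gaugeTransformZd_layerGauge_apply {b : ℕ} (k : Site 4 → G) (U : LGConfig 4 G) {e : ZdEdge 4}
    (he : e.1 0 ≤ (b : ℤ)) : gaugeTransformZd (layerGauge b k) U e = topTwist b k U e := by
  have h1 : layerGauge b k e.1 = 1 := by
    unfold layerGauge; rw [if_neg]; omega
  unfold gaugeTransformZd topTwist
  rw [h1, one_mul]
  have h0 := add_single_apply_zero e.1 e.2
  by_cases hi : e.2 = 0
  · by_cases hb : e.1 0 = (b : ℤ)
    · have hmem : ((e.1 + Pi.single e.2 (1 : ℤ) : Site 4)) 0 = (b : ℤ) + 1 := by rw [h0, if_pos hi, hb]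
      rw [if_pos ⟨hi, hb⟩]
      unfold layerGauge; rw [if_pos hmem, hi]
    · have hnm : ((e.1 + Pi.single e.2 (1 : ℤ) : Site 4)) 0 ≠ (b : ℤ) + 1 := by rw [h0, if_pos hi]; omega
      rw [if_neg (fun h => hb h.2)]
      unfold layerGauge; rw [if_neg hnm, inv_one, mul_one]
  · have hnm : ((e.1 + Pi.single e.2 (1 : ℤ) : Site 4)) 0 ≠ (b : ℤ) + 1 := by rw [h0, if_neg hi]; omega
    rw [if_neg (fun h => hi h.1)]
    unfold layerGauge; rw [if_neg hnm, inv_one, mul_one]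

/-- **PROVED.** Off the link layer `b` the twist changes nothing. -/
theorem topTwist_apply_of_ne {b : ℕ} (k : Site 4 → G) (U : LGConfig 4 G) {e : ZdEdge 4}
    (he : e.1 0 ≠ (b : ℤ)) : topTwist b k U e = U e := by
  unfold topTwist; rw [if_neg (fun h => he h.2)]

/-- Heights of the edges of a cell of the standard frame. -/
theorem base_height_of_mem_cellEdges {b : ℕ} {c : Fin 4 → ℤ} {e : ZdEdge 4}
    (he : e ∈ cellEdges (stdFrame b) c) :
    (b : ℤ) * c 0 + 1 ≤ e.1 0 ∧ e.1 0 < (b : ℤ) * (c 0 + 1) + 1 := by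
  have h := Fintype.mem_piFinset.1 (Finset.mem_product.1 he).1 0
  have h' := Finset.mem_Ico.1 h
  simp only [stdFrame, if_true] at h'
  exact h'

/-- **PROVED.** On every cell of the ROW LAYER (`c 0 = 0`: edges based at heights `1 … b`) the twist is the layer
gauge transformation — the typicality of the frozen RIM cells transfers by gauge invariance. -/
theorem topTwist_eq_gauge_on_rowLayer {b : ℕ} (k : Site 4 → G) (U : LGConfig 4 G) {c : Fin 4 → ℤ}
    (hc : c 0 = 0) : ∀ e ∈ cellEdges (stdFrame b) c,
      topTwist b k U e = gaugeTransformZd (layerGauge b k) U e := by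
  intro e he
  have h := base_height_of_mem_cellEdges he
  rw [hc] at h
  exact (gaugeTransformZd_layerGauge_apply k U (by linarith [h.2])).symm

/-- **PROVED.** On every cell OFF the row layer (`c 0 ≠ 0`) the twist is the identity (`1 ≤ b`). -/
theorem topTwist_eq_self_off_rowLayer {b : ℕ} (hb : 1 ≤ b) (k : Site 4 → G) (U : LGConfig 4 G)
    {c : Fin 4 → ℤ} (hc : c 0 ≠ 0) : ∀ e ∈ cellEdges (stdFrame b) c, topTwist b k U e = U e := by
  intro e he
  have h := base_height_of_mem_cellEdges he
  refine topTwist_apply_of_ne k U fun heq => ?_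
  have hb' : (1 : ℤ) ≤ b := by exact_mod_cast hb
  rcases lt_or_gt_of_ne hc with hlt | hgt
  · have : (b : ℤ) * (c 0 + 1) ≤ 0 := by nlinarith
    omega
  · have : (b : ℤ) ≤ (b : ℤ) * c 0 := by nlinarith
    omega

/-- **PROVED (the admissibility of the pair).** The (i_T) agreement hypothesis at `Y = rowCells n`: on the window cells
off the row, `ζ` and `topTwist b k ζ` agree edge by edge (the plates are NOT conjugated). -/
theorem topTwist_agree_off_row {b n : ℕ} (hb : 1 ≤ b) (k : Site 4 → G) (ζ : LGConfig 4 G) :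
    ∀ c ∈ windowCellsPlus n, c ∉ rowCells n → c ∈ windowCells n →
      ∀ e ∈ cellEdges (stdFrame b) c, ζ e = topTwist b k ζ e := by
  intro c _ hcr hcw e he
  have hc0 : c 0 ≠ 0 := fun h => hcr (Finset.mem_filter.2 ⟨hcw, h⟩)
  exact (topTwist_eq_self_off_rowLayer hb k ζ hc0 e he).symm

/-- **PROVED (sanity anchor).** For a CONSTANT CENTRAL `g₀` the rim-top twist is the tree's layer twist at layer `b`
by `g₀⁻¹` — the present chain then IS the landed central chain (cruxidea-8) read at the top layer. -/
theorem topTwist_const_eq_layerTwist {g₀ : G} (hg : g₀ ∈ Subgroup.center G) (b : ℕ) :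
    topTwist b (fun _ => g₀) = layerTwist (b : ℤ) g₀⁻¹ := by
  funext U e
  unfold topTwist layerTwist
  by_cases h : e.2 = 0 ∧ e.1 0 = (b : ℤ)
  · rw [if_pos h, if_pos h]
    have hg' : g₀⁻¹ ∈ Subgroup.center G := Subgroup.inv_mem _ hg
    show U e * g₀⁻¹ = g₀⁻¹ * U e
    exact Subgroup.mem_center_iff.1 hg' (U e)
  · rw [if_neg h, if_neg h]

end Geometry

/-! ## §2 Clause (i_T) at the row ⇒ the two-kernel bound for the admissible pair (PROVED) -/

section TwoKernel

variable {G : Type} [Group G] [TopologicalSpace G] [IsTopologicalGroup G] [CompactSpace G]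
  [SecondCountableTopology G] [MeasurableSpace G] [BorelSpace G]
  {N : ℕ} (ρ : G →* Matrix (Fin N) (Fin N) ℂ)

/-- **PROVED (S).** If `Typ` satisfies clause (i_T) at the standard frame, the datum `ζ` is typical TOGETHER WITH its
rim-top twist on the cells of window+shell off the row, and `u` is a cell-0 cylinder with `|u| ≤ 1`, then the row
kernels at `ζ` and at `topTwist b k ζ` give `u` means within `2ε` (single test `f = (1+u)/2`; NO charge identity is
used — the twisted kernel is NOT a gauge image of the untwisted one). -/
theorem abs_integral_sub_le_of_clauseI (hρ : Continuous ρ) {β : ℝ} {b n : ℕ} (hb : 1 ≤ b) {ε : ℝ}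
    {Typ : (Fin 4 → ℤ) → Set (LGConfig 4 G)} (hI : ClauseI ρ β (stdFrame b) n ε Typ)
    (k : Site 4 → G) {u : LGConfig 4 G → ℝ} (hum : Measurable u) (hub : ∀ U, |u U| ≤ 1)
    (hucyl : IsCylinder u (cellEdges (stdFrame b) 0)) (ζ : LGConfig 4 G)
    (hζ : ∀ c' ∈ windowCellsPlus n, c' ∉ rowCells n → ζ ∈ Typ c' ∧ topTwist b k ζ ∈ Typ c') :
    |(∫ U, u U ∂(ymSpecification ρ β (rowRegion b n) ζ)) -
        ∫ U, u U ∂(ymSpecification ρ β (rowRegion b n) (topTwist b k ζ))| ≤ 2 * ε := by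
  classical
  set μ := ymSpecification ρ β (rowRegion b n) ζ with hμ
  set μ' := ymSpecification ρ β (rowRegion b n) (topTwist b k ζ) with hμ'
  haveI : IsProbabilityMeasure μ := isProbabilityMeasure_ymSpecification ρ hρ β _ ζ
  haveI : IsProbabilityMeasure μ' := isProbabilityMeasure_ymSpecification ρ hρ β _ _
  have hcyl : IsCylinder (fun U => (1 + u U) / 2) (cellEdges (stdFrame b) 0) := by
    intro x y hxy
    show (1 + u x) / 2 = (1 + u y) / 2
    rw [hucyl hxy]
  have h01 : ∀ U, 0 ≤ (1 + u U) / 2 ∧ (1 + u U) / 2 ≤ 1 := fun U => by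
    have := abs_le.1 (hub U)
    constructor <;> linarith [this.1, this.2]
  have h : |(∫ U, (1 + u U) / 2 ∂μ) - ∫ U, (1 + u U) / 2 ∂μ'| ≤ ε :=
    hI (rowCells n) (rowCells_subset n) (zero_mem_rowCells n) ζ (topTwist b k ζ) hζ
      (topTwist_agree_off_row hb k ζ) _ hcyl ((measurable_const.add hum).div_const 2) h01
  have hi : ∀ ν : Measure (LGConfig 4 G), IsProbabilityMeasure ν → Integrable u ν := fun ν _ =>
    (integrable_const (1 : ℝ)).mono' hum.aestronglyMeasurable
      (ae_of_all _ fun U => by simpa [Real.norm_eq_abs] using hub U)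
  have hshift : ∀ ν : Measure (LGConfig 4 G), IsProbabilityMeasure ν →
      ∫ U, (1 + u U) / 2 ∂ν = (1 + ∫ U, u U ∂ν) / 2 := by
    intro ν hν
    have h1 : ∫ U, (1 + u U) ∂ν = 1 + ∫ U, u U ∂ν := by
      rw [integral_add (integrable_const _) (hi ν hν)]
      simp
    simp_rw [div_eq_mul_inv]
    rw [integral_mul_const, h1]
  rw [hshift μ inferInstance, hshift μ' inferInstance] at h
  have : (1 + ∫ U, u U ∂μ) / 2 - (1 + ∫ U, u U ∂μ') / 2 = ((∫ U, u U ∂μ) - ∫ U, u U ∂μ') / 2 := by ring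
  rw [this, abs_div, abs_two] at h
  linarith

end TwoKernel

/-! ## §3 The twisted staple (PROVED): `staple (topTwist b k ζ) = (A · k_m · A⁻¹) · staple ζ` -/

section Staple

variable {G : Type} [Group G]

/-- The TOP RUN of the staple: `A(ζ) = ζ(top₀) ⋯ ζ(top_{m-1})` at height `b + 1` (frozen upper-plate links). -/
def topRun (b m : ℕ) (ζ : LGConfig 4 G) : G :=
  ((List.range m).map fun s : ℕ => ζ (site2 ((b : ℤ) + 1) s, 1)).prod

/-- **PROVED.** The twist leaves the top run, the bottom run, the closing link and the lower rim links alone and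
replaces the rim's top link `ζ(b,m)` by `ζ(b,m) · k(b+1,m)⁻¹`; hence the twisted staple is the untwisted one
LEFT-multiplied by the `A`-conjugate of the corner value `k (site2 (b+1) m)`. -/
theorem staple_topTwist {b : ℕ} (hb : 1 ≤ b) (m : ℕ) (k : Site 4 → G) (ζ : LGConfig 4 G) :
    staple b m (topTwist b k ζ) =
      topRun b m ζ * k (site2 ((b : ℤ) + 1) m) * (topRun b m ζ)⁻¹ * staple b m ζ := by
  have htop : ((List.range m).map fun s : ℕ => topTwist b k ζ (site2 ((b : ℤ) + 1) s, 1)) =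
      (List.range m).map fun s : ℕ => ζ (site2 ((b : ℤ) + 1) s, 1) := by
    refine List.map_congr_left fun s _ => ?_
    unfold topTwist; rw [if_neg]; simp
  have hbot : (((List.range m).reverse).map fun s : ℕ => (topTwist b k ζ (site2 0 s, 1))⁻¹) =
      ((List.range m).reverse).map fun s : ℕ => (ζ (site2 0 s, 1))⁻¹ := by
    refine List.map_congr_left fun s _ => ?_
    unfold topTwist; rw [if_neg]; simp
  have hclose : topTwist b k ζ (site2 0 0, 0) = ζ (site2 0 0, 0) := by
    refine topTwist_apply_of_ne k ζ ?_
    simp only [site2_zero]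
    have : (1 : ℤ) ≤ b := by exact_mod_cast hb
    omega
  have hdown : (((List.range (b + 1)).reverse).map fun t : ℕ => (topTwist b k ζ (site2 t m, 0))⁻¹) =
      (k (site2 ((b : ℤ) + 1) m) * (ζ (site2 b m, 0))⁻¹) ::
        (((List.range b).reverse).map fun t : ℕ => (ζ (site2 t m, 0))⁻¹) := by
    rw [List.range_succ, List.reverse_append, List.reverse_singleton, List.singleton_append, List.map_cons]
    congr 1
    · have : topTwist b k ζ (site2 b m, 0) = ζ (site2 b m, 0) * (k (site2 ((b : ℤ) + 1) m))⁻¹ := by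
        have hc : (site2 (b : ℤ) (m : ℤ), (0 : Fin 4)).2 = 0 ∧ (site2 (b : ℤ) (m : ℤ), (0 : Fin 4)).1 0 = (b : ℤ) :=
          ⟨rfl, rfl⟩
        unfold topTwist
        rw [if_pos hc]
        show ζ (site2 b m, 0) * (k (site2 (b : ℤ) (m : ℤ) + Pi.single (0 : Fin 4) 1))⁻¹ = _
        rw [site2_add_single_zero]
      rw [this, mul_inv_rev, inv_inv]
    · refine List.map_congr_left fun t ht => ?_
      rw [topTwist_apply_of_ne k ζ]
      simp only [site2_zero]
      have ht' : t < b := by simpa using ht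
      omega
  have hdown0 : (((List.range (b + 1)).reverse).map fun t : ℕ => (ζ (site2 t m, 0))⁻¹) =
      (ζ (site2 b m, 0))⁻¹ :: (((List.range b).reverse).map fun t : ℕ => (ζ (site2 t m, 0))⁻¹) := by
    rw [List.range_succ, List.reverse_append, List.reverse_singleton, List.singleton_append, List.map_cons]
  unfold staple topRun
  rw [htop, hbot, hclose, hdown, hdown0, List.prod_cons, List.prod_cons]
  set A := ((List.range m).map fun s : ℕ => ζ (site2 ((b : ℤ) + 1) s, 1)).prod
  set R := (((List.range b).reverse).map fun t : ℕ => (ζ (site2 t m, 0))⁻¹).prod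
  set Bt := (((List.range m).reverse).map fun s : ℕ => (ζ (site2 0 s, 1))⁻¹).prod
  group

end Staple

/-! ## §4 The two named inputs (Props) and what they assert -/

section Inputs

variable {G : Type} [Group G] [TopologicalSpace G] [IsTopologicalGroup G] [CompactSpace G]
  [SecondCountableTopology G] [MeasurableSpace G] [BorelSpace G]
  {N : ℕ} (ρ : G →* Matrix (Fin N) (Fin N) ℂ)

/-- The FIELD-DEPENDENT rim-top twist `Φ_κ ζ = topTwist b (κ ζ) ζ`.  Intended `κ` (the card): `κ ζ x = P_x⁻¹ k₀ P_x`,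
`P_x` = `ζ`-transport from the corner `site2 (b+1) m` to `x` along a fixed spanning tree of the height-`(b+1)` links —
COVARIANTLY CONSTANT along those links, so that the gauge transformation `layerGauge b (κ ζ)` fixes every link it is
transported on, `κ (Φ_κ ζ) = κ ζ`, and in any gauge where the plates are flat the twist is the CONSTANT `k₀`. -/
def twistΦ (b : ℕ) (κ : LGConfig 4 G → Site 4 → G) (ζ : LGConfig 4 G) : LGConfig 4 G :=
  topTwist b (κ ζ) ζ

/-- **INPUT T — typicality transfers under the field-dependent twist (M).**  For every measurable CELL-LOCAL class
`Typ` and every cell of window+shell, the torus probability that the twisted lift is atypical is at most that of the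
lift itself.  MECHANISM: on row-layer cells `Φ_κ` is the gauge transformation `layerGauge b (κ ζ)` (§1), on all other
cells the identity; the map `V ↦ (layerGauge b (κ (lift V)) ∘ cRep) • V` preserves the torus Wilson measure although
the gauge function depends on the field — Fubini over the Haar fibres: `κ` reads only tree links, which the
transformation fixes (covariant constancy), and on the remaining links it acts fibrewise by translations; the Wilson
density is pointwise gauge invariant.  For CONSTANT CENTRAL `κ ≡ g₀` this is the tree's `twistedTypicalPairs` step
(`wilsonMeasure_map_gaugeTransform_holds`) via `topTwist_const_eq_layerTwist`. -/
def TopTwistTransfer (κ : LGConfig 4 G → Site 4 → G) (b n : ℕ) : Prop :=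
  ∀ (β : ℝ) (Typ : (Fin 4 → ℤ) → Set (LGConfig 4 G)),
    (∀ c, MeasurableSet (Typ c)) →
    (∀ c, DependsOn (fun σ : LGConfig 4 G => σ ∈ Typ c) ↑(cellEdges (stdFrame b) c)) →
    ∀ c ∈ windowCellsPlus n,
      (wilsonMeasure (d := 4) (L := 2 * ((2 * n + 2) * b + 1) + 1) ρ β)
          {V | twistΦ b κ (torusLift (2 * ((2 * n + 2) * b + 1) + 1) V) ∉ Typ c} ≤
        (wilsonMeasure (d := 4) (L := 2 * ((2 * n + 2) * b + 1) + 1) ρ β)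
          {V | torusLift (2 * ((2 * n + 2) * b + 1) + 1) V ∉ Typ c}

/-- The TWISTED-KERNEL mean of the σ-ADAPTED column test: `Ψ'(V) = ∫ Re tr ρ(col U · staple ζ)/N dγ_row(Φ_κ ζ)`,
`ζ = lift V` — the cell-0 column resampled under the TWISTED rim, read against the UNtwisted staple of `σ = ζ`. -/
def twistedMean (β : ℝ) (b n : ℕ) (κ : LGConfig 4 G → Site 4 → G)
    (V : GaugeConfig 4 (2 * ((2 * n + 2) * b + 1) + 1) G) : ℝ :=
  ∫ U, (chargedTest ρ b ((2 * n + 1) * b) (torusLift (2 * ((2 * n + 2) * b + 1) + 1) V) U).re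
    ∂(ymSpecification ρ β (rowRegion b n) (twistΦ b κ (torusLift (2 * ((2 * n + 2) * b + 1) + 1) V)))

/-- **INPUT F — the frame follows the rim (M–L; fixed-volume Laplace with boundary).**  With high torus probability the
twisted-kernel mean of the σ-adapted column test is at most `r + η` for `β ≥ β₀(η)`; intended `r = Re χ_ρ(k₀)/N`.
MECHANISM: by §3 and properness, under `γ_row(Φ_κ ζ)` one has `col U · staple ζ = (col U · staple (Φ_κ ζ)) · J`
up to conjugation, `J` conjugate to `k₀⁻¹`; the TWISTED-WORLD loop `col U · staple (Φ_κ ζ)` freezes at `1` as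
`β → ∞` at fixed `(b,n)` (the follow state `U_t ≡ k₀` in the flat gauge has ZERO deficit — every film, film–plate and
film–rim plaquette is `1` — and by planar Stokes every maximiser has loop `1`; uniform Laplace over the compact set of
`θ`-flat plate data, `θ`-flatness of the finitely many plate plaquettes being torus-typical by `torusLoopFreezing` +
Markov), whence `Re tr ρ(A J)/N → Re χ_ρ(k₀⁻¹)/N = r` by `|tr((A−1)J)| ≤ ‖A−1‖_HS √N` and Jensen.  For `κ ≡ 1` this IS
the tree's `torusLoopFreezing` + `integral_loopObs_torus` (with `r = 1`, useless, as it must be). -/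
def FrameValueBound (κ : LGConfig 4 G → Site 4 → G) (b n : ℕ) (r : ℝ) : Prop :=
  ∀ η : ℝ, 0 < η → ∃ β₀ : ℝ, ∀ β : ℝ, β₀ ≤ β →
    (wilsonMeasure (d := 4) (L := 2 * ((2 * n + 2) * b + 1) + 1) ρ β)
        {V | r + η < twistedMean ρ β b n κ V} ≤ ENNReal.ofReal η

end Inputs

/-! ## §5 The composition (PROVED): the frame-twist row refutes format T∕U clause (i) at every fixed mesh, any `G` -/

section Composition

variable {G : Type} [Group G] [TopologicalSpace G] [IsTopologicalGroup G] [CompactSpace G]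
  [SecondCountableTopology G] [MeasurableSpace G] [BorelSpace G]
  {N : ℕ} (ρ : G →* Matrix (Fin N) (Fin N) ℂ)

/-- **THE FRAME-TWIST ROW (composition, PROVED modulo the two named inputs).**  For every compact `G`, every continuous
faithful unitary `ρ` of degree `N ≥ 1`, every field-dependent rim-top twist `κ` satisfying INPUT T and INPUT F with a
value `r`, budgets `2ε < 1 − r`, `0 ≤ δ`, `4·#windowCellsPlus(n)·δ < 1`, every mesh `b ≥ 1` and window `n`:
`∃ β₀ ∀ β ≥ β₀, ¬ TypShellCond ρ β b n ε δ`.  NO centre, NO scalar hypothesis `ρ g₀ = c • 1`: the intended instance is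
ANY `k₀ ≠ 1` (`r = Re χ_ρ(k₀)/N < 1` by faithfulness), in particular centreless `G` (`SO(3)`, `G₂`, `F₄`, `E₈`, `PSU(N)`). -/
theorem not_typShellCond_frame (hρ : Continuous ρ) (hρi : Function.Injective ρ)
    (hρu : ∀ g, ρ g ∈ Matrix.unitaryGroup (Fin N) ℂ) (hN : 1 ≤ N)
    {b : ℕ} (hb : 1 ≤ b) (n : ℕ) (κ : LGConfig 4 G → Site 4 → G) {r : ℝ}
    (hT : TopTwistTransfer ρ κ b n) (hF : FrameValueBound ρ κ b n r)
    {ε δ : ℝ} (hε : 2 * ε < 1 - r)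
    (hδ0 : 0 ≤ δ) (hδ : 4 * ((windowCellsPlus n).card : ℝ) * δ < 1) :
    ∃ β₀ : ℝ, ∀ β : ℝ, β₀ ≤ β → ¬ TypShellCond ρ β b n ε δ := by
  classical
  -- budgets
  set s : ℝ := min ((1 - r - 2 * ε) / 4) (1 / 8) with hs
  have hs0 : 0 < s := lt_min (by linarith) (by norm_num)
  have hs8 : s ≤ 1 / 8 := min_le_right _ _
  have hs4 : s ≤ (1 - r - 2 * ε) / 4 := min_le_left _ _
  -- the rectangle width and the torus
  have hm : (((2 * n + 1) * b : ℕ) : ℤ) = (2 * (n : ℤ) + 1) * b := by push_cast; ring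
  obtain ⟨β₁, hβ₁⟩ := torusLoopFreezing ρ hρ hρi hρu hN hb ((2 * n + 1) * b) ((2 * n + 2) * b + 1)
    (θ := 1 - s * s) (by nlinarith)
  obtain ⟨β₂, hβ₂⟩ := hF s hs0
  refine ⟨max β₁ β₂, fun β hβ hTyp => ?_⟩
  have hβ1 : β₁ ≤ β := (le_max_left _ _).trans hβ
  have hβ2 : β₂ ≤ β := (le_max_right _ _).trans hβ
  set L : ℕ := 2 * ((2 * n + 2) * b + 1) + 1 with hL
  set μ := wilsonMeasure (d := 4) (L := L) ρ β with hμ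
  haveI : IsProbabilityMeasure μ := isProbabilityMeasure_wilsonMeasure ρ hρ β
  set Λ := rowRegion b n with hΛ
  set m : ℕ := (2 * n + 1) * b with hmdef
  set F : LGConfig 4 G → ℝ := loopObs ρ b m with hFdef
  set Ψ : GaugeConfig 4 L G → ℝ := fun V => ∫ U, F U ∂(ymSpecification ρ β Λ (torusLift L V)) with hΨ
  set Ψ' : GaugeConfig 4 L G → ℝ := twistedMean ρ β b n κ with hΨ'
  -- the format at the standard frame
  obtain ⟨Typ, hmeas, hdep, hI, hanch⟩ := clauseI_of_typShellCond hTyp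
  have hanch' : ∀ c' ∈ windowCellsPlus n,
      μ {V : GaugeConfig 4 L G | torusLift L V ∉ Typ c'} ≤ ENNReal.ofReal δ := fun c' hc' =>
    hanch ((2 * n + 2) * b + 1) (by nlinarith) c' (stdFrame_windowCellsPlus_bounds hc')
  -- INPUT T: the twisted lifts are typical too (union bound over window+shell; outer measure, no measurability needed)
  set A : (Fin 4 → ℤ) → Set (GaugeConfig 4 L G) := fun c => {V | torusLift L V ∉ Typ c} with hA
  set T : (Fin 4 → ℤ) → Set (GaugeConfig 4 L G) := fun c => {V | twistΦ b κ (torusLift L V) ∉ Typ c} with hTset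
  have hμT : ∀ c ∈ windowCellsPlus n, μ (T c) ≤ ENNReal.ofReal δ := fun c hc =>
    (hT β Typ hmeas hdep c hc).trans (hanch' c hc)
  set B : Set (GaugeConfig 4 L G) := ⋃ c ∈ windowCellsPlus n, (A c ∪ T c) with hB
  have hμB : μ B ≤ ENNReal.ofReal (2 * ((windowCellsPlus n).card : ℝ) * δ) := by
    calc μ B ≤ ∑ c ∈ windowCellsPlus n, μ (A c ∪ T c) := measure_biUnion_finset_le _ _
      _ ≤ ∑ c ∈ windowCellsPlus n, (ENNReal.ofReal δ + ENNReal.ofReal δ) :=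
          Finset.sum_le_sum fun c hc =>
            (measure_union_le _ _).trans (add_le_add (hanch' c hc) (hμT c hc))
      _ = ENNReal.ofReal (2 * ((windowCellsPlus n).card : ℝ) * δ) := by
          rw [Finset.sum_const, nsmul_eq_mul, ← ENNReal.ofReal_add hδ0 hδ0, ← ENNReal.ofReal_natCast,
            ← ENNReal.ofReal_mul (Nat.cast_nonneg _)]
          congr 1
          ring
  have hgood : ∀ V ∉ B, ∀ c ∈ windowCellsPlus n, c ∉ rowCells n →
      torusLift L V ∈ Typ c ∧ twistΦ b κ (torusLift L V) ∈ Typ c := by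
    intro V hV c hc _
    simp only [hB, Set.mem_iUnion, Set.mem_union, not_exists, not_or] at hV
    have h := hV c hc
    exact ⟨of_not_not h.1, of_not_not h.2⟩
  -- §2 on the good set: `Ψ V − Ψ' V ≤ 2ε`
  have hpair : ∀ V ∉ B, Ψ V - Ψ' V ≤ 2 * ε := by
    intro V hV
    have hprop : Ψ V = ∫ U, (chargedTest ρ b m (torusLift L V) U).re
        ∂(ymSpecification ρ β Λ (torusLift L V)) := integral_loopObs_eq ρ hρ β hm _
    have h2 := abs_integral_sub_le_of_clauseI ρ hρ hb hI (κ (torusLift L V))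
      (u := fun U => (chargedTest ρ b m (torusLift L V) U).re)
      (Complex.measurable_re.comp (measurable_chargedTest ρ hρ b m _))
      (fun U => (Complex.abs_re_le_norm _).trans (norm_chargedTest_le ρ hρu b m _ U))
      (fun x y hxy => by
        show (chargedTest ρ b m (torusLift L V) x).re = (chargedTest ρ b m (torusLift L V) y).re
        rw [chargedTest_isCylinder ρ hb m _ hxy])
      (torusLift L V) (hgood V hV)
    rw [hprop]
    exact (le_abs_self _).trans h2
  -- INPUT F: the bad-value set
  set C : Set (GaugeConfig 4 L G) := {V | r + s < Ψ' V} with hC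
  have hμC : μ C ≤ ENNReal.ofReal s := hβ₂ β hβ2
  -- freezing + Markov: the low-loop set
  set D : Set (GaugeConfig 4 L G) := {V | s ≤ 1 - Ψ V} with hD
  have hΨ1 : ∀ V, |Ψ V| ≤ 1 := fun V =>
    abs_integral_ymSpecification_le ρ hρ β Λ (abs_loopObs_le ρ hρu b _) _
  have hΨm : Measurable Ψ :=
    ((continuous_integral_ymSpecification ρ hρ β Λ (continuous_loopObs ρ hρ b _)
      (abs_loopObs_le ρ hρu b _)).comp (continuous_torusLift L)).measurable
  have hΨi : Integrable Ψ μ :=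
    (integrable_const (1 : ℝ)).mono' hΨm.aestronglyMeasurable
      (ae_of_all _ fun V => by simpa [Real.norm_eq_abs] using hΨ1 V)
  have h1Ψi : Integrable (fun V => 1 - Ψ V) μ := (integrable_const _).sub hΨi
  have hfreeze : 1 - s * s ≤ ∫ V, F (torusLift L V) ∂μ := hβ₁ β hβ1
  have hDLR : ∫ V, F (torusLift L V) ∂μ = ∫ V, Ψ V ∂μ := integral_loopObs_torus ρ hρ hρu β hm
  have hE : ∫ V, (1 - Ψ V) ∂μ ≤ s * s := by
    rw [integral_sub (integrable_const _) hΨi, integral_const]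
    simp only [Measure.real, measure_univ, ENNReal.toReal_one, smul_eq_mul, one_mul]
    linarith
  have hMarkov : s * μ.real D ≤ ∫ V, (1 - Ψ V) ∂μ :=
    mul_meas_ge_le_integral_of_nonneg (ae_of_all _ fun V => by
      have := (abs_le.1 (hΨ1 V)).2; show (0 : ℝ) ≤ 1 - Ψ V; linarith) h1Ψi s
  have hμD : μ.real D ≤ s := by
    have : s * μ.real D ≤ s * s := hMarkov.trans hE
    exact le_of_mul_le_mul_left this hs0
  -- the three bad sets do not cover the torus
  have hμB' : μ.real B ≤ 2 * ((windowCellsPlus n).card : ℝ) * δ :=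
    ENNReal.toReal_le_of_le_ofReal (by positivity) hμB
  have hμC' : μ.real C ≤ s := ENNReal.toReal_le_of_le_ofReal hs0.le hμC
  have hcover : μ.real (B ∪ C ∪ D) < 1 := by
    calc μ.real (B ∪ C ∪ D) ≤ μ.real (B ∪ C) + μ.real D := measureReal_union_le _ _
      _ ≤ μ.real B + μ.real C + μ.real D := by
          have := measureReal_union_le (μ := μ) B C; linarith
      _ < 1 := by nlinarith
  have hex : ∃ V, V ∉ B ∪ C ∪ D := by
    by_contra hne
    push Not at hne
    have huniv : B ∪ C ∪ D = Set.univ := Set.eq_univ_of_forall hne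
    rw [huniv] at hcover
    simp [Measure.real] at hcover
  obtain ⟨V, hV⟩ := hex
  simp only [Set.mem_union, not_or] at hV
  obtain ⟨⟨hVB, hVC⟩, hVD⟩ := hV
  have h1 : Ψ V - Ψ' V ≤ 2 * ε := hpair V hVB
  have h2 : Ψ' V ≤ r + s := not_lt.1 hVC
  have h3 : 1 - Ψ V < s := not_le.1 hVD
  linarith

end Composition

end Summit.QuantumFields.YangMills.Cruxes.IR.CruxIdea2g5

end
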